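import Mathlib
import HarnessLib
import Summits.HubbardSuperconductivity.HubbardSuperconductivity.Theorems.KLProgrammeKLRegimeSplitPredicatesV2

/-!
# Route `KLProgramme` — crux K3 `KLRegimeTwoPointLimit` (stmt-HubbardSuperconductivity-19937): per-scale predicates, VERSION 3 —
# `EngineBoundsAtV3` / `BetaSplitAtV3` / `klPredsV3` (cell gate-hubbard-kl, seat p1 = C1 lead, g5)

WHY A V3 (HOME/STATUS p1b 10:13:54Z Δ7, plan 10:14:56Z, p1 11:3xZ r9).  V2 (`…SplitPredicatesV2`, p438859) repaired the vacuous
arrays and the envelope-vs-value gap, but its (E2′-v2) `TupleIncrementL1At` still read the two-shell gains at the CENTRE transfer of a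
tuple: at a forward tuple (legs `0,1` in one sector ⇒ centre transfer `0`, true transfer up to the sector width) the scale-`n` increment is
`≍ U²` at its own resolution for EVERY `n`, so no `G` with `G.WF`'s `Σ_n phGain n ρ ≤ CF` can satisfy it (Δ7); and on ANISOTROPIC tuples
(tangential length `≍ 2^{-m}`) a forward tuple straddles `≈ m/2` transfer scales, so the anisotropic endpoint line (BGM (2.71b)) is not
derivable by summing increments beyond `|h| ≍ 1/U` at all (r9; its truth at `O(U)` is open).  V3 therefore:

* states the per-scale increments POINTWISE IN MOMENTUM, at the configuration's TRUE transfers — (E2′-v3) `QuarticValueIncrementAt` on the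
  running coupling VALUE `klQuarticValue … n σ σ' k₁ k₂ k₃` (`vertexFn` in BGM field order `ψ⁺_{k₁σ}ψ⁻_{k₂σ}ψ⁺_{k₃σ'}ψ⁻_{k₄σ'}`, `k₄ = k₁−k₂+k₃`,
  frequencies `(ω₀, ω₀, −ω₀, −ω₀)`; non-vacuous) — so that the LANDED two-argument gains `G.ppGain n ρ`, `G.phGain n ρ` and the LANDED `G.WF`
  summability (pp: `Σ_{n∈(t,N]} ≤ CF` off the pair class; ph: `Σ_n ≤ CF` at every true transfer, the single-scale static bubble vanishing AT
  transfer `0` by Lemma E.2) are exactly what child 1 sums — no reading window, no resolution index, no new record field;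
* replaces the tuple-level engine output by ONE values-⇒-`L¹` clause for ISOTROPIC tuples of every class, (E5-v3) `IsoTupleL1At` (an
  isotropic tuple leaves `≈ log₄190 ≈ 4` transfer scales unresolved — `O(1)`, the tree expansion's decay; implication form);
* keeps only the ISOTROPIC endpoint line in child 1's output, (B2-v3) `EndpointNormLineIso` (BGM (2.71a)), plus the VALUE line
  `QuarticValueLine` (`|λ_n| ≤ Klam|U|` on the ball) which the engine's second-order diagrams (drive, remainders) consume instead of
  anisotropic `L¹` norms; the ANISOTROPIC line (2.71b) is DEFERRED to r9 (engine's sector bookkeeping: E5A-NOTE §0.4 vs iso counting);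
* (E2-v3) `PairLadderStepAtV3` = V2's cascade form (inverse witness, source-indexed) with the `n = 0` clause for ALL total momenta
  (p3's Q-a / plan V3-2; `pairLadderStepAtV3_imp` gives back V2's `PairLadderStepAt`, so p3's row-0′ module transfers verbatim);
* (E1-v3) `KernelNormsV3`: BGM (2.77) with the sign-blind-derivable coupling size `ε_n = Klam·(|U| + U²·n)` in place of `Klam|U|`
  (`≤ Klam(|U| + c/ln 4)` in the regime; r9: anisotropic sector sums see the Landau-channel lacunarity; (E1) feeds only child 4's
  volume-uniform bounds and the engine's own induction — the U-power-sensitive Cooper bookkeeping is value-built and NOT weakened);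
* keeps V2's (E2″-v2) `PairValueIncrementAt`, (B1-v2) `PairArrayAt`, and v1's (E0) (E4) (B4) verbatim.
This is the planner's reconciled text «V3-R» (HOME/STATUS plan g9 11:43:11Z (1)–(7)) — names of record `EngineBoundsAtV3`,
`BetaSplitAtV3 := PairArrayAt ∧ EndpointLineV3 ∧ FirstMoments`, `klPredsV3`; children `EngineP|BetaSplitP|CountertermP|TwoPointAssemblyP
klPredsV3 klWindowC`; glue (downstream) `KLRegimeInductionV3 := KLRegimeInductionP klPredsV3`.  OPEN (banked, not hidden): r9/r10 —
the engine's internal norm system on anisotropic forward tuples (E5A-NOTE §0.4 wants anisotropic sectors; the Landau channel makes their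
fixed-tuple L¹ `≍ U²n`); the predicates below do not constrain that choice.

SUPPLIER MAP (consumer ⇐ suppliers; owner):
| (B1-v2) `PairArrayAt n` (every `Q`)            | (E2-v2) `PairLadderStepAt j≤n` resummed [pair-class `Q`] / (B1-v2)(t) + (E2″-v2)(t<j≤n) [exited `Q`] | child 1 (p3 row 0′; toolkit p436217/p440132/…Lipschitz) |
| `QuarticValueLine n`, config with `|k₁+k₃|_𝕋 ≤ 4^{-n}` | (B1-v2) `PairArrayAt n` (pair kinematics = BGM order `(k′, k, Q−k′)` at frequencies `(ω₀,ω₀,−ω₀,−ω₀)`, even leg permutation) | child 1 |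
| `QuarticValueLine n`, config exited the pair class at `t < n` | value at `t` (`PairArrayAt t`, Hist) + Σ_{j∈(t,n]} (E2′-v3) with `G.WF` at the TRUE transfers | child 1 (p1b row 2′) |
| (B2-v3) `EndpointNormLineIso n`                   | `QuarticValueLine n` ⇒ (E5-v3) `IsoTupleL1At n` with `B = Klam|U|`·(const)                    | child 1 (one line)  |
| (B4) `FirstMoments n`                            | (E4) `EngineFirstMoments n`                                                                    | child 1 (one line)  |
| (E0)(E1)(E2-v2)(E2″-v2)(E2′-v3)(E4)(E5-v3) at `n` | `HistP`: `QuarticValueLine`(j<n) values, `EndpointNormLineIso`(j<n), `RenormalisedAt`(j<n), (B4)(j<n) | child 3 (tree expansion) |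
Definitions with bodies only; nothing is asserted about the model.  References: HOME/STATUS lines cited above; HOME/prover-p1b/GAINS-NOTE.md;
HOME/p1/E2-NOTE.md (zero-sound cancellation, p412973); BGM 2006 (2.25), (2.71), §3.
-/

noncomputable section

namespace Summit.HubbardSuperconductivity.HubbardSuperconductivity.Theorems.KLRegimeSplit

set_option linter.dupNamespace false -- summit = problem name (single-conjunct summit), D-0017

open Real Finset Literature.MathematicalPhysics.QuantumLattice Literature.Probability.LatticeModels
open Summit.HubbardSuperconductivity.HubbardSuperconductivity.Theorems.KLProgrammeLegKernels

/-! ## §1 The running coupling VALUES (BGM field order) -/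

section Model

variable (L M : ℕ) [NeZero L] [NeZero M]

/-- **The running coupling value of the scale-`n` action** in BGM's field order (2.25): `λ_n^{σσ'}(k₁,k₂,k₃) =
𝒱₄(ψ̂⁺_{(ω₀,k₁)σ}, ψ̂⁻_{(ω₀,k₂)σ}, ψ̂⁺_{(-ω₀,k₃)σ'}, ψ̂⁻_{(-ω₀,k₁-k₂+k₃)σ'})` (`vertexFn`; fourth momentum by conservation; bare value `+U`
for `σ ≠ σ'`, `0` for `σ = σ'`).  Particle–particle transfer `k₁ + k₃`, direct particle–hole transfer `k₁ − k₂`, exchange `k₂ − k₃`. -/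
def klQuarticValue (β U μ : ℝ) (K : TrigPolyC4v) (n : ℕ) (σ σ' : Fin 2) (k₁ k₂ k₃ : TorusSite 2 L) : ℂ :=
  vertexFn L M β (klEffectiveAction L M β U μ K klE0 n) 4
    ![(((omega0 M, k₁), σ), 0), (((omega0 M, k₂), σ), 1), ((((omega0 M).rev, k₃), σ'), 0),
      ((((omega0 M).rev, k₁ - k₂ + k₃), σ'), 1)]

/-- The torus sup-distance of a lattice momentum to `2πℤ²` (`|p_k|_𝕋`). -/
def klTorusNorm (k : TorusSite 2 L) : ℝ := torusSupNorm (latticeMomentum L k 0, latticeMomentum L k 1)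

/-! ## §2 V3 clauses -/

/-- **The sign-blind coupling size** `ε_n = Klam·(|U| + U²·n)` (r9: what summing per-scale increments certifies for an anisotropic
endpoint; `≤ Klam(|U| + c/ln 4)` for `n ≤ n_β` in the regime). -/
def epsCoupling (P : SplitConsts) (U : ℝ) (n : ℕ) : ℝ := P.Klam * (|U| + U ^ 2 * n)

/-- **(E1-v3) kernel norms of the scale-`n` action** — BGM Thm 2.1 (2.77) for OUR action, level 1, anisotropic sector sums, every leg
number, with the coupling size `ε_n`: `‖W_{2p}‖_{1,aniso} ≤ CE^p · ε_n^{max(1,p-1)} · 2^{(3p-5)n}`. -/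
def KernelNormsV3 (P : SplitConsts) (Q : EngConsts) (β U μ : ℝ) (K : TrigPolyC4v) (n : ℕ) : Prop :=
  ∀ p : ℕ, 1 ≤ p →
    klAnisoLegKernelNorm L M β U μ K klE0 n (2 * p) ≤
      Q.CE ^ p * (epsCoupling P U n) ^ (max 1 (p - 1)) * (2 : ℝ) ^ ((3 * (p : ℤ) - 5) * n)

/-- **(E2-v3) the one-step ladder identity with remainder, array level** — V2's `PairLadderStepAt` with the ultraviolet clause for
ALL total momenta: at `n = 0`, `|𝒞₀(Q;k,k') − U| ≤ initDevBar` for every `Q` and all momenta of the ball; at `n ≥ 1`, for every `Q`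
in the pair class at resolution `n`, slice weights `w ≥ 0` of mass `≤ bhi` and an inverse witness `N` of `1 + diag(w)·A`
(`A = klPairArray … (n-1) Q`) with `|𝒞_n(Q;k,k') − (A·N)(k,k')| ≤ drivePBar (n-1) + ē_{n-1}` on the ball (cascade form, source-indexed). -/
def PairLadderStepAtV3 (G : GeoConsts) (P : SplitConsts) (Q : EngConsts) (β U μ : ℝ) (K : TrigPolyC4v) (n : ℕ) : Prop :=
  (n = 0 → ∀ Qm : TorusSite 2 L, ∀ k ∈ klBall L μ K, ∀ k' ∈ klBall L μ K,
      ‖klPairAmplitude L M β U μ K 0 Qm k k' - (U : ℂ)‖ ≤ initDevBar G U) ∧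
  (1 ≤ n → ∀ Qm : TorusSite 2 L, IsPairClassAt L Qm n →
      ∃ w : TorusSite 2 L → ℝ, (∀ p, 0 ≤ w p) ∧ (∑ p, w p ≤ G.bhi) ∧
        ∃ N : Matrix (TorusSite 2 L) (TorusSite 2 L) ℂ,
          (1 + Matrix.diagonal (fun p => (w p : ℂ)) * klPairArray L M β U μ K (n - 1) Qm) * N = 1 ∧
          ∀ k ∈ klBall L μ K, ∀ k' ∈ klBall L μ K,
            ‖klPairAmplitude L M β U μ K n Qm k k' - (klPairArray L M β U μ K (n - 1) Qm * N) k k'‖ ≤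
              drivePBar G P U (n - 1) + eremBar G P Q U β L (n - 1))

/-- **(E2′-v3) pointwise increments of the running coupling values at the TRUE transfers** (what child 1 sums off the pair class):
at `n ≥ 1`, for all spins and all momenta of the ball,
`|λ_n(k₁,k₂,k₃) − λ_{n-1}(k₁,k₂,k₃)| ≤ gainBar n (|k₁+k₃|_𝕋) (|k₁−k₂|_𝕋) (|k₂−k₃|_𝕋) + ē_{n-1}` — the two-shell bubbles of Lemma E.1/E.3
read at the configuration's own transfers (no sector window: at transfer `0` the single-scale static particle–hole bubble vanishes, E.2). -/
def QuarticValueIncrementAt (G : GeoConsts) (P : SplitConsts) (Q : EngConsts) (β U μ : ℝ) (K : TrigPolyC4v) (n : ℕ) : Prop :=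
  1 ≤ n → ∀ (σ σ' : Fin 2), ∀ k₁ ∈ klBall L μ K, ∀ k₂ ∈ klBall L μ K, ∀ k₃ ∈ klBall L μ K,
    ‖klQuarticValue L M β U μ K n σ σ' k₁ k₂ k₃ - klQuarticValue L M β U μ K (n - 1) σ σ' k₁ k₂ k₃‖ ≤
      gainBar G P U n (klTorusNorm L (k₁ + k₃)) (klTorusNorm L (k₁ - k₂)) (klTorusNorm L (k₂ - k₃)) +
        eremBar G P Q U β L (n - 1)

/-- **(E2′-v3, n = 0) the ultraviolet size of the running coupling values**: `|λ₀(k₁,k₂,k₃)| ≤ |U| + initDevBar` on the ball. -/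
def QuarticValueUVAt (G : GeoConsts) (β U μ : ℝ) (K : TrigPolyC4v) (n : ℕ) : Prop :=
  n = 0 → ∀ (σ σ' : Fin 2), ∀ k₁ ∈ klBall L μ K, ∀ k₂ ∈ klBall L μ K, ∀ k₃ ∈ klBall L μ K,
    ‖klQuarticValue L M β U μ K 0 σ σ' k₁ k₂ k₃‖ ≤ |U| + initDevBar G U

/-- **(E5-v3) values ⇒ fixed-tuple `L¹` on ISOTROPIC tuples of every class** (implication form; what (B2-v3) consumes): if the scale-`n`
running coupling values are bounded by `B ≥ 0` on the ball, then for every resolution `m ≥ n`, every isotropic label 4-tuple of BGM's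
conservation set and every pinned point, the fixed-tuple `L¹` size of the scale-`n` quartic kernel sectorised at resolution `m` is
`≤ CF·B + CF·(Klam U)²` (an isotropic tuple leaves `O(1)` transfer scales unresolved; decay of the tree expansion; off-shell and
other-frequency values cost the summable second-order term). -/
def IsoTupleL1At (G : GeoConsts) (P : SplitConsts) (β U μ : ℝ) (K : TrigPolyC4v) (n : ℕ) : Prop :=
  ∀ B : ℝ, 0 ≤ B →
    (∀ (σ σ' : Fin 2), ∀ k₁ ∈ klBall L μ K, ∀ k₂ ∈ klBall L μ K, ∀ k₃ ∈ klBall L μ K,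
        ‖klQuarticValue L M β U μ K n σ σ' k₁ k₂ k₃‖ ≤ B) →
      ∀ m : ℕ, n ≤ m → ∀ Ω ∈ bgmSectorSet L M (klIsoFamily L M β μ K klE0 m) 4, ∀ x₁ : SpaceTimeIdx L M,
        fixedTupleL1 L M β 3 (klIsoKernelAt L M β U μ K n m) Ω x₁ ≤ G.CF * B + G.CF * (P.Klam * U) ^ 2

/-- **`QuarticValueLine n`** (child 1's value-level endpoint line, consumed by the engine's second-order diagrams instead of anisotropic
`L¹` norms): `|λ_n^{σσ'}(k₁,k₂,k₃)| ≤ Klam·|U|` for all spins and all momenta of the ball. -/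
def QuarticValueLine (P : SplitConsts) (β U μ : ℝ) (K : TrigPolyC4v) (n : ℕ) : Prop :=
  ∀ (σ σ' : Fin 2), ∀ k₁ ∈ klBall L μ K, ∀ k₂ ∈ klBall L μ K, ∀ k₃ ∈ klBall L μ K,
    ‖klQuarticValue L M β U μ K n σ σ' k₁ k₂ k₃‖ ≤ P.Klam * |U|

/-- **(B2-v3) the ISOTROPIC endpoint norm line** (BGM (2.71a); the anisotropic line (2.71b) is deferred to r9): the first conjunct of v1's
`EndpointNormLine`. -/
def EndpointNormLineIso (P : SplitConsts) (β U μ : ℝ) (K : TrigPolyC4v) (n : ℕ) : Prop :=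
  ∀ Ω ∈ bgmSectorSet L M (klIsoFamily L M β μ K klE0 n) 4, ∀ x₁ : SpaceTimeIdx L M,
    fixedTupleL1 L M β 3 (klLegKernel L M β U μ K klE0 n 4) Ω x₁ ≤ P.Klam * |U|

/-- **`EndpointLineV3`** = (B2-v3): the ISOTROPIC endpoint norm line ∧ the VALUE line (plan V3-R (4)). -/
def EndpointLineV3 (P : SplitConsts) (β U μ : ℝ) (K : TrigPolyC4v) (n : ℕ) : Prop :=
  EndpointNormLineIso L M P β U μ K n ∧ QuarticValueLine L M P β U μ K n

/-- **`EngineBoundsAtV3 … G P Q K n`** = (E0) ∧ (E1-v3) ∧ (E2-v3) ∧ (E2″-v2) ∧ (E2′-v3 incl. its UV clause) ∧ (E4) ∧ (E5-v3) at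
scale `h = -n`.  Same slot type as `Preds.engine`. -/
def EngineBoundsAtV3 (G : GeoConsts) (P : SplitConsts) (Q : EngConsts) (β U μ : ℝ) (K : TrigPolyC4v) (n : ℕ) : Prop :=
  SelfEnergySymmetric L M β U μ K n ∧ KernelNormsV3 L M P Q β U μ K n ∧
    PairLadderStepAtV3 L M G P Q β U μ K n ∧ PairValueIncrementAt L M G P Q β U μ K n ∧
      QuarticValueIncrementAt L M G P Q β U μ K n ∧ QuarticValueUVAt L M G β U μ K n ∧
        EngineFirstMoments L M G P Q β U μ K n ∧ IsoTupleL1At L M G P β U μ K n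

/-- **`BetaSplitAtV3 … G P Q K n`** := `PairArrayAt ∧ EndpointLineV3 ∧ FirstMoments` (plan V3-R (4); (B1-v2), (B2-v3), (B4)).
Same slot type as `Preds.split`; `G`, `Q` are not read. -/
def BetaSplitAtV3 (_G : GeoConsts) (P : SplitConsts) (_Q : EngConsts) (β U μ : ℝ) (K : TrigPolyC4v) (n : ℕ) : Prop :=
  PairArrayAt L M P β U μ K n ∧ EndpointLineV3 L M P β U μ K n ∧ FirstMoments L M P β U μ K n

end Model

/-! ## §3 The V3 bundle -/

/-- **`klPredsV3 : Preds`** := `{ frameOK := FrameOK, renorm := RenormalisedAt, split := BetaSplitAtV3, engine := EngineBoundsAtV3,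
twoLeg := TwoLegStep }`; children of record `EngineP klPredsV3 klWindowC`, `BetaSplitP …`, `CountertermP …`, `TwoPointAssemblyP …`;
glue line (downstream): `KLRegimeInductionV3 := KLRegimeInductionP klPredsV3`. -/
def klPredsV3 : Preds where
  frameOK := FrameOK
  renorm := fun L M _ _ β U μ K R n => RenormalisedAt L M β U μ K R n
  split := fun L M _ _ G P Q β U μ K n => BetaSplitAtV3 L M G P Q β U μ K n
  engine := fun L M _ _ G P Q β U μ K n => EngineBoundsAtV3 L M G P Q β U μ K n
  twoLeg := fun L M _ _ G P Q R β U μ K n => TwoLegStep L M G P Q R β U μ K n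

/-! ## §4 Bookkeeping (`rfl`-level) -/

section Model

variable (L M : ℕ) [NeZero L] [NeZero M]

omit [NeZero L] in
/-- `|p_0|_𝕋 = 0`: the zero momentum is in every pair class. -/
theorem klTorusNorm_zero : klTorusNorm L (0 : TorusSite 2 L) = 0 := by
  have h0 : torusAbs 0 = 0 := by
    rw [torusAbs, (toIocMod_eq_self _).2 ⟨by linarith [Real.pi_pos], by linarith [Real.pi_pos]⟩, abs_zero]
  simp [klTorusNorm, torusSupNorm, latticeMomentum, h0]

/-- The V3 ladder step implies V2's (the ultraviolet clause for all `Q` implies it for the pair class), so the row-0′ wrapper on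
`PairLadderStepAt` (p3, `KLProgrammeKLRegimeSplitPairLadder`) transfers verbatim. -/
theorem pairLadderStepAtV3_imp (G : GeoConsts) (P : SplitConsts) (Q : EngConsts) (β U μ : ℝ) (K : TrigPolyC4v) (n : ℕ)
    (h : PairLadderStepAtV3 L M G P Q β U μ K n) : PairLadderStepAt L M G P Q β U μ K n :=
  ⟨fun hn Qm _ k hk k' hk' => h.1 hn Qm k hk k' hk', h.2⟩

omit [NeZero M] in
/-- (B2-v3)'s isotropic conjunct is the isotropic half of v1's (B2). -/
theorem endpointNormLine_iso (P : SplitConsts) (β U μ : ℝ) (K : TrigPolyC4v) (n : ℕ)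
    (h : EndpointNormLine L M P β U μ K n) : EndpointNormLineIso L M P β U μ K n := h.1

end Model

end Summit.HubbardSuperconductivity.HubbardSuperconductivity.Theorems.KLRegimeSplit

end
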